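/-
Origin: expansion seat `prover-pub-hodgecm-mc-binder-2-g7-0`, handover #11 18:30Z md5 b2bd53abc56b (132 l.; imports #8 + the twin of `KonnoKonno2007/RealUnitaryDualPairNegate` — INSTALL AFTER both, DROP-ONLY-THIS-ROW if the twin is absent; `exists_isArchWeilDatum_slot_neg [IsEmpty P'] [Nonempty Q'] [Subsingleton R'] r₀ s₀` (the NEGATIVELY read census slot, from #8 on the doubly role-swapped slot + `RealDualPair.isArchWeilDatum_negSwap`), `exists_isArchWeilDatum_slot_of_definite` (either orientation by cases), `cmBlockRepAt_one_hypV_tensorPi_slot_neg` / `tendsto_cmBlockRepAt_one_hypV_tensorPi_sub_div_slot_neg`; farm amalgam (tree leaf inlined pre-landing) rc 0 / 0 warn; axioms trio) (`HOME/mc/pub-hodgecm-mc-binder-2/g7/pkg/HodgeCM/Model/HypCensus/SmoothBlockSlotNeg.lean`, md5 b2bd53ab, 132 lines);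
landed by the gen-13 packager (p-g13) in gate run 37 as `HodgeCM/Model/HypCensus/SmoothBlockSlotNeg.lean` (verbatim).
-/
/-
Origin: speedrun cell pub-hodgecm, MODEL-CONSTRUCTION sub-cell, lineage mc-binder-2 (rows A12/A34 of the binder ledger:
`hyp12` / `hyp34`), seat prover-pub-hodgecm-mc-binder-2-g7-0 (gen 7), 2026-08-19.  Target in PKG:
`HodgeCM/Model/HypCensus/SmoothBlockSlotNeg.lean` (NEW additive leaf; imports this lineage's `SmoothBlockSlot` and the K-1 twin of
the tree leaf `KonnoKonno2007/RealUnitaryDualPairNegate` (binder-2-g7, hub proposal p192918) — install only after that twin exists).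
KERNEL only: 0 records / named facts / proof holes.
-/
import Summits.HodgeConjecture.HodgeCM.Model.HypCensus.SmoothBlockSlot
import Literature.RepresentationTheory.KonnoKonno2007.RealUnitaryDualPairNegate

/-!
# Census kit (rows A12/A34), junction (J-smooth): the small datum of the NEGATIVELY read census slot

At a real place `v` of type `Σ₁₂` the canonical sign convention `cmSignConv` of the (J-arch) datum (weil-2,
`ArchDualPairThetaMajorants` :730) is `im σ_{w(v)}(δ_L)`, of uncontrolled sign, so the definite space `V_v` may be read as
`U(∅, Fin 3)` and the plane `W_v` as `U(S', R')` (model1 18:02:37Z).  `SmoothBlockSlot.exists_isArchWeilDatum_slot` covers the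
positively read slot (`Q' = ∅`); this leaf covers the other one by the ROLE-SWAP SYMMETRY of Konno–Konno's junction
(`RealDualPair.isArchWeilDatum_negSwap`: negating both hermitian forms is the block relabelling `Sum.swap ⊕ Sum.swap` of `DPIdx`,
polarisation preserved):

* **`exists_isArchWeilDatum_slot_neg [IsEmpty P'] [Nonempty Q'] [Subsingleton R']`** — from the positive lemma on the doubly swapped
  slot `(Q', P', S', R')`;
* **`exists_isArchWeilDatum_slot_of_definite`** — either orientation, by cases (the shape the census assembly consumes place by
  place: `PosIdx = univ ∨ NegIdx = univ` at a definite place);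
* the `SmoothBlock` value/slope with the small datum discharged in the negative orientation
  (`cmBlockRepAt_one_hypV_tensorPi_slot_neg`, `tendsto_cmBlockRepAt_one_hypV_tensorPi_sub_div_slot_neg`).

Nothing here is a claim of PerL/QW8.  Style lint (L-notation): no `local notation`.
-/

set_option autoImplicit false

noncomputable section

open Filter Topology
open NumberField NumberField.InfinitePlace IsDedekindDomain MeasureTheory
open scoped Matrix
open scoped Kronecker Classical TensorProduct ComplexConjugate
open Literature.NumberTheory.Automorphic Literature.NumberTheory.Automorphic.UnitaryGroup Literature.NumberTheory.Weil1964
open Literature.RepresentationTheory.HeisenbergGroup (polar Heisenberg symplecticGroup ofSymplectic)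
open Literature.RepresentationTheory.KonnoKonno2007 Literature.RepresentationTheory.KonnoKonno2007.RealDualPair
open Literature.NumberTheory.GelbartRogawski1991 Literature.NumberTheory.GelbartRogawski1991.UnitaryDualPair
open Literature.Analysis.SegalBargmann Literature.Analysis.Distribution

namespace HodgeCM.Model.HypCensus

/-! ## §1 The negatively read slot, and either orientation -/

section SlotNeg

variable {P' Q' R' S' : Type} [Fintype P'] [DecidableEq P'] [Fintype Q'] [DecidableEq Q'] [Fintype R'] [DecidableEq R']
  [Fintype S'] [DecidableEq S']

/-- **The negatively read census slot** (`V_v` read as `U(∅, Q')`, `W_v ≅ U(S', R')` flipped along): an archimedean Weil datum with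
continuous operators EXISTS — the positive lemma on the doubly role-swapped slot `U(Q',∅) × U(S',R')`, read back through
`isArchWeilDatum_negSwap`. [KonnoKonno2007, §3.1; Folland1989, §4.2 Prop. (4.39)] -/
theorem exists_isArchWeilDatum_slot_neg [IsEmpty P'] [Nonempty Q'] [Subsingleton R'] (r₀ : R') (s₀ : S') :
    ∃ ω₁ : Representation ℂ (Ginf P' Q' R' S') (SchwartzMap (DPIdx P' Q' R' S' → ℝ) ℂ),
      IsArchWeilDatum (ι𝕎 P' Q' R' S') ω₁ ∧ ∀ u, Continuous (ω₁ u) := by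
  obtain ⟨ω, hω, hc⟩ := exists_isArchWeilDatum_slot (P' := Q') (Q' := P') (R' := S') (S' := R') s₀ r₀
  exact ⟨_, isArchWeilDatum_negSwap hω, continuous_negSwap_apply hc⟩

/-- **The census slot at a definite place, EITHER orientation**: one `V`-block empty and the other inhabited, both `W`-blocks
subsingletons with points (`W_v ≅ U(1,1)`) ⇒ a small archimedean Weil datum with continuous operators exists.
[KonnoKonno2007, §3.1; Folland1989, §4.2 Prop. (4.39)] -/
theorem exists_isArchWeilDatum_slot_of_definite [Subsingleton R'] [Subsingleton S']
    (hV : (IsEmpty Q' ∧ Nonempty P') ∨ (IsEmpty P' ∧ Nonempty Q')) (r₀ : R') (s₀ : S') :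
    ∃ ω₁ : Representation ℂ (Ginf P' Q' R' S') (SchwartzMap (DPIdx P' Q' R' S' → ℝ) ℂ),
      IsArchWeilDatum (ι𝕎 P' Q' R' S') ω₁ ∧ ∀ u, Continuous (ω₁ u) := by
  rcases hV with ⟨hQ, hP⟩ | ⟨hP, hQ⟩
  · haveI := hQ; haveI := hP
    exact exists_isArchWeilDatum_slot r₀ s₀
  · haveI := hQ; haveI := hP
    exact exists_isArchWeilDatum_slot_neg r₀ s₀

end SlotNeg

/-! ## §2 `SmoothBlock` §1/§2 in the negatively read slot, small datum discharged -/

section CMPinSmoothSlotNeg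

variable (L : Type) [Field L] [NumberField L] [IsCMField L] {N M n : ℕ} (e : Fin N × Fin M ≃ Fin n)
variable (dV : Fin N → L) (hdV : ∀ i, IsCMField.complexConj L (dV i) = dV i) (hdV0 : ∀ i, dV i ≠ 0)
variable (dW : Fin M → L) (hdW : ∀ i, IsCMField.complexConj L (dW i) = dW i) (hdW0 : ∀ i, dW i ≠ 0)
variable (hGR : (cmSplittingDatum L e dV hdV hdV0 dW hdW hdW0).CompatibleSplitting) (ι₁ : L →+* ℂ)
variable (v : {v : InfinitePlace ↥(maximalRealSubfield L) // v.IsReal})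
variable {P' Q' R' S' : Type} [Fintype P'] [DecidableEq P'] [Fintype Q'] [DecidableEq Q'] [Fintype R'] [DecidableEq R']
  [Fintype S'] [DecidableEq S']
variable (eP : PosIdx (cmXV L dV hdV ι₁ v) ≃ P') (eQ : NegIdx (cmXV L dV hdV ι₁ v) ≃ Q')
  (eR : PosIdx (cmXW L dV dW hdW ι₁ v) ≃ R') (eS : NegIdx (cmXW L dV dW hdW ι₁ v) ≃ S')
variable
  (h₁V : ∃ i₀ : Fin N, (∀ i, i ≠ i₀ → 0 < (ι₁ (dV i)).re) ∨ ∀ i, i ≠ i₀ → (ι₁ (dV i)).re < 0)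
  (h₁W : (∀ j, 0 < (ι₁ (dW j)).re) ∨ ∀ j, (ι₁ (dW j)).re < 0)
  (hV : ∀ τ : L →+* ℂ, InfinitePlace.mk τ ≠ InfinitePlace.mk ι₁ →
    (∀ i, 0 < (τ (dV i)).re) ∨ ∀ i, (τ (dV i)).re < 0)
  (hW : ∀ τ : L →+* ℂ, InfinitePlace.mk τ ≠ InfinitePlace.mk ι₁ →
    (∃ j₀ : Fin M, ∀ j, j ≠ j₀ → 0 < (τ (dW j)).re) ∨ ∀ j, (τ (dW j)).re < 0)

include h₁V h₁W hV hW in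
/-- **(J-smooth), exact value, negatively read census slot.** [Folland1989, Prop. (1.43), §4.2 (4.23), (4.24), Prop. (4.39)] -/
theorem cmBlockRepAt_one_hypV_tensorPi_slot_neg [IsEmpty P'] [Nonempty Q'] [Subsingleton R'] (r₀ : R') (s₀ : S') (t : ℝ)
    (Φ₁ : SchwartzMap (DPIdx P' Q' R' S' → ℝ) ℂ)
    (Φ₂ : SchwartzMap (Fin n × {w : {w : InfinitePlace ↥(maximalRealSubfield L) // w.IsReal} // w ≠ v} → ℝ) ℂ) :
    cmBlockRepAt L e dV hdV hdV0 dW hdW hdW0 hGR ι₁ v eP eQ eR eS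
        (cmBlockSectionAt L dV hdV hdV0 dW hdW hdW0 ι₁ v eP eQ eR eS
          (((1 : UForm P' Q'), (hypV r₀ s₀ t : UForm R' S')) : Ginf P' Q' R' S'))
        (tensorPi Φ₁ Φ₂) =
      tensorPi (hypOpW P' Q' r₀ s₀ t Φ₁) Φ₂ := by
  obtain ⟨ω₁, hW₁, hc₁⟩ := exists_isArchWeilDatum_slot_neg (P' := P') (Q' := Q') r₀ s₀
  exact cmBlockRepAt_cmBlockSectionAt_one_hypV_tensorPi L e dV hdV hdV0 dW hdW hdW0 hGR ι₁ v eP eQ eR eS h₁V h₁W hV hW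
    hW₁ hc₁ r₀ s₀ t Φ₁ Φ₂

include h₁V h₁W hV hW in
/-- **(J-smooth), the slope, negatively read census slot.** [Folland1989, (4.24), Prop. (4.39)] -/
theorem tendsto_cmBlockRepAt_one_hypV_tensorPi_sub_div_slot_neg [IsEmpty P'] [Nonempty Q'] [Subsingleton R'] (r₀ : R')
    (s₀ : S') (Φ₁ : SchwartzMap (DPIdx P' Q' R' S' → ℝ) ℂ)
    (Φ₂ : SchwartzMap (Fin n × {w : {w : InfinitePlace ↥(maximalRealSubfield L) // w.IsReal} // w ≠ v} → ℝ) ℂ) :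
    Tendsto (fun t : ℝ => ((t : ℝ) : ℂ)⁻¹ •
        (cmBlockRepAt L e dV hdV hdV0 dW hdW hdW0 hGR ι₁ v eP eQ eR eS
            (cmBlockSectionAt L dV hdV hdV0 dW hdW hdW0 ι₁ v eP eQ eR eS
              (((1 : UForm P' Q'), (hypV r₀ s₀ t : UForm R' S')) : Ginf P' Q' R' S'))
            (tensorPi Φ₁ Φ₂) - tensorPi Φ₁ Φ₂))
      (𝓝[≠] 0) (𝓝 (tensorPi (hypOpWGen P' Q' r₀ s₀ Φ₁) Φ₂)) := by
  obtain ⟨ω₁, hW₁, hc₁⟩ := exists_isArchWeilDatum_slot_neg (P' := P') (Q' := Q') r₀ s₀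
  exact tendsto_cmBlockRepAt_one_hypV_tensorPi_sub_div L e dV hdV hdV0 dW hdW hdW0 hGR ι₁ v eP eQ eR eS h₁V h₁W hV hW
    hW₁ hc₁ r₀ s₀ Φ₁ Φ₂

end CMPinSmoothSlotNeg

end HodgeCM.Model.HypCensus

end
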